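import Summits.Ventures.QEC.Census.AdditiveCertLanesSound
import Summits.Ventures.QEC.Census.CertCheckBZBridge
import Summits.Ventures.QEC.Census.CertBZChunks
import Summits.Ventures.QEC.Census.CertBZInfoSets
import Summits.Ventures.QEC.Census.CertBZPlaneSound
import HarnessLib

/-!
# General-stabilizer (`AddCert`) certificates, V: the Brouwer–Zimmermann branch on the 3n-bit binary image (data + checks)

The replays of `Census/AdditiveCertCheck.lean` / `AdditiveCertChunks.lean` / `AdditiveCertLanes*.lean` visit every Pauli
word of weight `≤ d − 1`; for the `d ≥ 7` objects of the `n ≤ 30` census (`[[29,0,11]]`, `[[30,0,12]]`, … :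
`2·10⁷ … 4.8·10¹³` words) that is out of reach. This file is the additive analogue of the CSS checker's method `bz`
(`Census/CertCheckBZ.lean`, qec-type-10): Brouwer–Zimmermann enumeration with Zimmermann's relative ranks
([cite: Grassl2006, §2.1 Algorithm 2.5] = `Literature/InformationTheory/Coding/BrouwerZimmermannBound.lean`, qec-type-07),
applied to the BINARY IMAGE of the normaliser: the `𝔽₂`-linear map
`τ : Ē = 𝔽₂ⁿ × 𝔽₂ⁿ → 𝔽₂^{3n}`, `(x | z) ↦ (x | z | x + z)` (`tauLin`; on packed words `tau3`) is injective and DOUBLES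
the weight (`wt τ(w) = 2 · swt w`: a non-identity letter `X, Z, Y` has exactly two of `x_j, z_j, x_j + z_j` set), so
"no element of `S̄⊥ ∖ S̄` of symplectic weight `≤ d − 1`" is "every codeword of the binary `[3n, n + k]` code `τ(S̄⊥)`
of Hamming weight `≤ 2d − 2` lies in `τ(S̄)`" — a statement the tree's binary BZ machinery decides from information
sets of the `3n`-bit generator matrix (3 nearly disjoint information sets give depth `≈ 2d/3` per matrix:
`[[30,0,12]]` needs `≈ 10⁷` row selections instead of `4.8·10¹³` Pauli words).

DATA (`AddBZData`, next to an `AddCert` `c`): `gens` — `n + k` INDEPENDENT generators of `S̄⊥ = N(S)` as packed Pauli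
words, with a symplectic rank table `ginv` (`⟨gens[a], ginv[i]⟩ = [a = i]`); `mats` — type-10's `BZMatrix` records
(`T` = information set ⊆ `[0, 3n)` ordered by pivot row, `A` = selection words over the rows `G_b := gens.map (tau3 n)`,
`t` = depth). CHECKS (Bool, `decide`): `checkStructureL` (type-02/qec-search-5: commutation, rank table of the rows,
upper witness, allow-list decompositions + bounds), `gensOK` (count `|gens| + |rows| = 2n`, zero syndromes, bounds, rank
table), `matsOK` (per matrix type-10's `matrixSysOK` at width `3n` + `|T| = |G_b|`, and the recounted relative-rank bound
`bzBoundList (3n) |G_b| mats 0 > 2d − 2`), and per matrix the ENUMERATION VERDICT `bzEnum i` = type-10's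
`matrixEnumOK (2d − 2) (allowList.map (tau3 n)) G_b mats[i]` — supplied by qec-type-01's lane engine
(`Plane.segOK` segments, `Plane.reaches_of_segList`, `matrixEnumOK_of_reaches`), never by `decide` on the scan itself.
SOUNDNESS (`isAdditiveCode_of_bz`, `minDistance_code_of_bz`, `isPure_of_bz`; control: the `[[5,1,3]]` code through two
information sets of its `15`-bit image) is the sibling file `Census/AdditiveCertBZSound.lean`. The allow-list is
`c.allowList` (the `found` words for `k > 0`, nothing for `k = 0`), so a `k = 0` certificate proves "no nonzero
stabilizer below weight `d`" outright. No distance value is asserted here; nothing trusts the producer.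
-/

set_option autoImplicit false

namespace Summit.Ventures.QEC.Census

open Matrix Finset Literature.InformationTheory.QuantumCodes Literature.InformationTheory.Coding

/-! ## The binary image `τ` -/

/-- `τ` on packed Pauli words: the `3n`-bit word `x ‖ z ‖ (x ⊕ z)` (bits `[0,n)` = `x`, `[n,2n)` = `z`,
`[2n,3n)` = `x ⊕ z`). Its popcount is twice the Pauli weight. (definition) [folklore] -/
def tau3 (n : ℕ) (w : ℕ × ℕ) : ℕ := w.1 ||| (w.2 <<< n) ||| ((w.1 ^^^ w.2) <<< (2 * n))

/-- The three blocks of the image as a function of (block, position): block `0` = `x`, block `1` = `z`,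
block `2` = `x + z`. (definition) [folklore] -/
def tauBlock {n : ℕ} (w : SympVec n) (p : Fin 3 × Fin n) : ZMod 2 :=
  if p.1 = 0 then w.1 p.2 else if p.1 = 1 then w.2 p.2 else w.1 p.2 + w.2 p.2

/-- **The binary image `τ : Ē → 𝔽₂^{3n}`** as a linear map; coordinate `j + n·a` of `τ w` is block `a` at position `j`
(Mathlib's `finProdFinEquiv : Fin 3 × Fin n ≃ Fin (3n)`). (definition) [folklore] -/
def tauLin (n : ℕ) : SympVec n →ₗ[ZMod 2] (Fin (3 * n) → ZMod 2) where
  toFun w i := tauBlock w (finProdFinEquiv.symm i)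
  map_add' v w := by
    funext i
    simp only [tauBlock, Pi.add_apply, Prod.fst_add, Prod.snd_add]
    split_ifs <;> simp only [add_add_add_comm]
  map_smul' a v := by
    funext i
    simp only [tauBlock, Pi.smul_apply, Prod.smul_fst, Prod.smul_snd, smul_eq_mul, RingHom.id_apply]
    split_ifs <;> simp only [mul_add]

/-! ## Data and checks -/

/-- Brouwer–Zimmermann data for an additive certificate: a basis of the normaliser with its symplectic rank table,
and the enumeration matrices over the `3n`-bit image of that basis. [cite: Grassl2006, §2.1 Algorithm 2.5] -/
structure AddBZData where
  /-- `n + k` independent generators of `S̄⊥ = N(S)/phases`, packed `(x-mask, z-mask)` -/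
  gens : List (ℕ × ℕ)
  /-- symplectic rank table: `⟨gens[a], ginv[i]⟩ ≡ [a = i]` -/
  ginv : List (ℕ × ℕ)
  /-- enumeration matrices over `G_b = gens.map (tau3 n)`: information set `T`, selection words `A`, depth `t` -/
  mats : List BZMatrix

namespace AddCert

variable (c : AddCert) (z : AddBZData)

/-- The block matrix of the BZ branch: the `3n`-bit images of the normaliser generators. (definition) -/
def gb3 : List ℕ := z.gens.map (tau3 c.n)

/-- The allow-list of the BZ branch: the `3n`-bit images of `c.allowList` (the `found` words for `k > 0`, `[]` for
`k = 0`). (definition) -/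
def allow3 : List ℕ := c.allowList.map (tau3 c.n)

/-- The binary-weight threshold `2(d − 1)`: a Pauli word of weight `≤ d − 1` has image weight `≤ 2d − 2` (image
weights are even, so this is the sharp threshold; the relative-rank bound must exceed it). (definition) -/
def bzW : ℕ := 2 * (c.d - 1)

/-- `gensOK`: `|gens| + |rows| = 2n`, every generator commutes with every row (zero syndrome) and lives on the `n`
qubits, `|ginv| = |gens|`, and the rank table `⟨gens[a], ginv[i]⟩ ≡ [a = i] (mod 2)` (⇒ independence ⇒ `span gens =
S̄⊥` by dimension count). (definition) -/
def gensOK : Bool :=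
  (z.gens.length + c.rows.length == 2 * c.n) && (z.ginv.length == z.gens.length) &&
    (z.gens.all fun g => sympSynZero c.n c.rows g && decide (g.1 < 2 ^ c.n) && decide (g.2 < 2 ^ c.n)) &&
    ((List.range z.gens.length).all fun a => (List.range z.gens.length).all fun i =>
      sympParity c.n (z.gens.getD a (0, 0)) (z.ginv.getD i (0, 0)) == (if a = i then 1 else 0))

/-- `matsOK`: every matrix is systematic on its information set at width `3n` with rows below `2^{3n}` (type-10's
`matrixSysOK`) and has `|T| = |G_b|` columns, and the recounted relative-rank bound exceeds the threshold:
`2(d − 1) < Σ_i (t_i + 1 − (|G_b| − r_i))⁺`. (definition) [cite: Grassl2006, §2.1 Algorithm 2.5] -/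
def matsOK : Bool :=
  (z.mats.all fun mt => matrixSysOK (3 * c.n) (c.gb3 z) mt && (mt.T.length == (c.gb3 z).length)) &&
    decide (c.bzW < bzBoundList (3 * c.n) (c.gb3 z).length z.mats 0)

/-- **All structural checks of the BZ branch**: the lane-form structural checks of the certificate (`checkStructureL`:
commutation, rank table, upper witness, allow-list decompositions and bounds), `gensOK` and `matsOK`. (definition) -/
def checkBZ : Bool := c.checkStructureL && c.gensOK z && c.matsOK z

/-- The ENUMERATION VERDICT of matrix `i` (type-10's `matrixEnumOK` at threshold `2(d − 1)` with the image allow-list;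
`true` past the end). It is established from lane segments (`bzEnum_of_reaches` in the soundness file), never by
evaluating this `scan`. (definition) -/
def bzEnum (i : ℕ) : Bool :=
  match z.mats[i]? with
  | none => true
  | some mt => matrixEnumOK c.bzW c.allow3 (c.gb3 z) mt

end AddCert

/-! ## Control data: the `[[5,1,3]]` code (`certC513`) through two information sets of its 15-bit image -/

/-- BZ data for `certC513`: a basis of the normaliser of the `[[5,1,3]]` code (`6 = n + k` packed words with their
rank partners) and two enumeration matrices of depth `2` on the disjoint information sets `{0,…,5}` and `{6,…,11}` of
the `15`-bit image (relative ranks `6, 6`: bound `(2 + 1 − 0) + (2 + 1 − 0) = 6 > 4 = 2·(3 − 1)`; `2 · 21` row selections).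
(definition; generated by qec-type-02's `bz3_data.py`) -/
def bzC513 : AddBZData where
  gens := [(1, 18), (2, 26), (4, 10), (8, 20), (16, 22), (0, 31)]
  ginv := [(0, 1), (20, 1), (29, 1), (15, 1), (10, 1), (1, 0)]
  mats := [{ T := [0, 1, 2, 3, 4, 5], A := [1, 2, 4, 8, 16, 32], t := 2 },
           { T := [6, 7, 8, 9, 10, 11], A := [43, 61, 28, 53, 44, 51], t := 2 }]

end Summit.Ventures.QEC.Census
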